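import Summits.BirchSwinnertonDyer.Rank1Residual.P2.ShuZhaiThirtySixTable
import Summits.BirchSwinnertonDyer.Rank1Residual.WAll.TargetCMTwoSlices
import HarnessLib
import HarnessLib.Audit.Tags

/-!
# Rung W-ALL of ladder BSD (D-0120) — the INERT slices of row 12₂ (`WAllCornerFTwoInertGood ∧
# WAllCornerFTwoInertBad`: CM, `ord_{s=1} L(E,s) = 1`, `2` inert in the CM field) cut ONCE, flag-free:
# ON / OFF the `ℚ`-isogeny classes of the explicit Shu–Zhai twists of `36a1` (cell `bsd-print-cf2`,
# seat p3; the two-way cut route `PrintCf2` can split its crux `InertTwoRankOneOfFacts`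
# (stmt-BirchSwinnertonDyer-20363) along)

HONEST FRAMING (cell `bsd-print-cf2`, run/shared/lean/pub/bsd-print-cf2/): STATEMENTS AND BOOKKEEPING
ONLY in §1–§2 — nothing asserted, nothing booked, no named fact, no published theorem restated; the two
`@[conjecture] def`s below are OPEN obligations and SLICES of the registered leaf
`Summit.BirchSwinnertonDyer.WAllCornerFTwo` (via seat p4's `WAll/TargetCMTwoSlices.lean`, p532371),
cut by ONE decidable-in-principle predicate: `P2.IsIsogenousToShuZhaiThirtySixTwist W` ("`W` is
`ℚ`-isogenous to `36a1^{(−p∏q)}` for some prime `p ≡ 23 (mod 24)` and some finite set `Q` of primes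
`≡ 5 (mod 12)` with `∏ q ≡ 1 (mod 24)`", `P2/ShuZhaiThirtySixTable.lean`). §3 is the CLOSER of the
ON-leaf granted seven named facts BY NAME (`P2.cornerFTwo_shuZhaiThirtySix_isogenyClass_byName`:
Shu–Zhai 2021 Thm 1.2 / 1.4, Cassels, row C8 = Burungale–Flach 2024, modularity, Agashe–Ribet–Stein
2006 Thm 2.6, Shu–Zhai §5.2 Table row 36a1) — every one a cite-tagged statement-only `Prop` of the tree;
beyond-print: NO. The OFF-leaf is the named residual of the p3 road inside the inert slices: every
cube-sum curve `x³ + y³ = n` (the K7t leaf `X12.CMAtTwo` = 𝒞_HSY among them), every other `j = 0`,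
`54000`, `−12288000` curve of analytic rank one, and the five odd Heegner fields — no theorem in print.

| slice `Prop` (this file) | shape (all `∀ W [..] [..], W.HasCM → W.analyticRank = 1 → CMInert W 2 → …`) | status |
|---|---|---|
| `WAllCornerFTwoInertShuZhaiThirtySix` | `… → P2.IsIsogenousToShuZhaiThirtySixTwist W → BSDp W 2` | CLOSED granted facts (§3) |
| `WAllCornerFTwoInertOffShuZhaiThirtySix` | `… → ¬ P2.IsIsogenousToShuZhaiThirtySixTwist W → BSDp W 2` | OPEN (the residual) |

§2 glue (excluded middle only): `(InertGood ∧ InertBad) ⟺ (ON ∧ OFF)` EXACT; each ⇐ `WAllCornerFTwo`.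

References: `WAll/TargetCMTwoSlices.lean` (p4's slices and `cmNonsplitRankOneAtTwo_iff_nonsplitSlices`),
`P2/ShuZhaiThirtySix{Curve,Admissible,Slices,Reduction,IsogenyClass,Table}.lean` (p3), route file
`Theses/PrintCf2.lean` item 20363; [cite: ShuZhai2021, Thm. 1.2, Thm. 1.4, §5.2 Table row 36a1];
[cite: Miller2011LMS, Def. 1.1] (the currency `BSD(E,p)`).
-/

noncomputable section

open scoped Classical

open WeierstrassCurve Literature.NumberTheory.EllipticCurves
  Literature.NumberTheory.EllipticCurves.Rank1Residual Literature.NumberTheory.EllipticCurves.ModularForms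
  Literature.NumberTheory.EllipticCurves.ShuZhai2021
open Summit.BirchSwinnertonDyer.Rank1Residual

set_option autoImplicit false

namespace Summit.BirchSwinnertonDyer

/-! ### §1. The inert slices cut along the Shu–Zhai `36a1` isogeny classes -/

/-- **Inert slices ON THE SHU–ZHAI `36a1` ISOGENY CLASSES** (closed granted named facts by
`wAllCornerFTwoInertShuZhaiThirtySix_of_facts`, §3): CM, `ord_{s=1} L(E,s) = 1`, `2` inert in `K`, `W`
`ℚ`-isogenous to an explicit twist `36a1^{(−p∏q)}` ⇒ `BSD(E,2)`. [folklore] -/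
@[conjecture] def WAllCornerFTwoInertShuZhaiThirtySix : Prop :=
  ∀ (W : WeierstrassCurve ℚ) [W.IsElliptic] [W.IsGloballyMinimal],
    W.HasCM → W.analyticRank = 1 → CMInert W 2 → P2.IsIsogenousToShuZhaiThirtySixTwist W → BSDp W 2

/-- **Inert slices OFF THE SHU–ZHAI `36a1` ISOGENY CLASSES (OPEN) — the residual of the p3 road.** CM,
`ord_{s=1} L(E,s) = 1`, `2` inert in `K`, `W` NOT `ℚ`-isogenous to any explicit Shu–Zhai twist of `36a1`
⇒ `BSD(E,2)`. Contains every cube-sum curve (𝒞_HSY = K7t `X12.CMAtTwo` included) and the five odd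
Heegner fields; nothing in print. [folklore] -/
@[conjecture] def WAllCornerFTwoInertOffShuZhaiThirtySix : Prop :=
  ∀ (W : WeierstrassCurve ℚ) [W.IsElliptic] [W.IsGloballyMinimal],
    W.HasCM → W.analyticRank = 1 → CMInert W 2 → ¬ P2.IsIsogenousToShuZhaiThirtySixTwist W → BSDp W 2

/-! ### §2. Glue (excluded middle on membership; good/bad at `2`) -/

/-- **The two inert slices ⟺ ON the Shu–Zhai classes ∧ OFF them** (EXACT; pure logic: `Good ∨ ¬ Good`
one way, membership `∨` non-membership the other). [folklore] -/
theorem wAllCornerFTwoInert_iff_shuZhai_offShuZhai :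
    (WAllCornerFTwoInertGood ∧ WAllCornerFTwoInertBad) ↔
      WAllCornerFTwoInertShuZhaiThirtySix ∧ WAllCornerFTwoInertOffShuZhaiThirtySix := by
  constructor
  · rintro ⟨hG, hB⟩
    refine ⟨fun W _ _ hcm hr1 hin _ ↦ ?_, fun W _ _ hcm hr1 hin _ ↦ ?_⟩ <;>
    · by_cases hg : Good W 2
      · exact hG W hcm hr1 hin hg
      · exact hB W hcm hr1 hin hg
  · rintro ⟨hS, hO⟩
    refine ⟨fun W _ _ hcm hr1 hin _ ↦ ?_, fun W _ _ hcm hr1 hin _ ↦ ?_⟩ <;>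
    · by_cases h1 : P2.IsIsogenousToShuZhaiThirtySixTwist W
      · exact hS W hcm hr1 hin h1
      · exact hO W hcm hr1 hin h1

/-- The inert slices from their two parts. [folklore] -/
theorem wAllCornerFTwoInert_of_shuZhai_of_offShuZhai (hS : WAllCornerFTwoInertShuZhaiThirtySix)
    (hO : WAllCornerFTwoInertOffShuZhaiThirtySix) : WAllCornerFTwoInertGood ∧ WAllCornerFTwoInertBad :=
  wAllCornerFTwoInert_iff_shuZhai_offShuZhai.2 ⟨hS, hO⟩

/-- The ON-leaf is implied by the row-12₂ leaf (it is a slice of it). [folklore] -/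
theorem wAllCornerFTwoInertShuZhaiThirtySix_of_wAllCornerFTwo (h : WAllCornerFTwo) :
    WAllCornerFTwoInertShuZhaiThirtySix :=
  fun W _ _ hcm hr1 _ _ ↦ h W hcm hr1

/-- The OFF-leaf (the residual) is implied by the row-12₂ leaf. [folklore] -/
theorem wAllCornerFTwoInertOffShuZhaiThirtySix_of_wAllCornerFTwo (h : WAllCornerFTwo) :
    WAllCornerFTwoInertOffShuZhaiThirtySix :=
  fun W _ _ hcm hr1 _ _ ↦ h W hcm hr1

/-- **Row 12₂ ⟺ split-good ∧ split-bad ∧ ramified ∧ (inert ON Shu–Zhai) ∧ (inert OFF Shu–Zhai)** — p4's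
five-way cut with the two inert slices replaced by the present two-way cut (EXACT). [folklore] -/
theorem wAllCornerFTwo_iff_slices_shuZhai :
    WAllCornerFTwo ↔ WAllCornerFTwoSplitGood ∧ WAllCornerFTwoSplitBad ∧ WAllCornerFTwoRamified ∧
      WAllCornerFTwoInertShuZhaiThirtySix ∧ WAllCornerFTwoInertOffShuZhaiThirtySix := by
  rw [wAllCornerFTwo_iff_slices]
  constructor
  · rintro ⟨hSG, hSB, hR, hIG, hIB⟩
    exact ⟨hSG, hSB, hR, wAllCornerFTwoInert_iff_shuZhai_offShuZhai.1 ⟨hIG, hIB⟩⟩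
  · rintro ⟨hSG, hSB, hR, hSO⟩
    exact ⟨hSG, hSB, hR, wAllCornerFTwoInert_iff_shuZhai_offShuZhai.2 hSO⟩

/-- **The sub-lane target `P2.CMNonsplitRankOneAtTwo` ⟺ ramified ∧ (inert ON) ∧ (inert OFF).** [folklore] -/
theorem cmNonsplitRankOneAtTwo_iff_ramified_shuZhai_offShuZhai :
    P2.CMNonsplitRankOneAtTwo ↔
      WAllCornerFTwoRamified ∧ WAllCornerFTwoInertShuZhaiThirtySix ∧ WAllCornerFTwoInertOffShuZhaiThirtySix := by
  rw [cmNonsplitRankOneAtTwo_iff_nonsplitSlices]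
  constructor
  · rintro ⟨hR, hIG, hIB⟩
    exact ⟨hR, wAllCornerFTwoInert_iff_shuZhai_offShuZhai.1 ⟨hIG, hIB⟩⟩
  · rintro ⟨hR, hSO⟩
    exact ⟨hR, wAllCornerFTwoInert_iff_shuZhai_offShuZhai.2 hSO⟩

/-! ### §3. The ON-leaf CLOSED granted the named facts (by name) -/

/-- **`WAllCornerFTwoInertShuZhaiThirtySix` holds granted, BY NAME: Cassels' isogeny invariance
(`hCassels`), Shu–Zhai 2021 Thm 1.2 (`h12`) and Thm 1.4 (`h14`), the CM rank-zero row C8 (`hCM`,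
Burungale–Flach 2024 / Rubin), modularity (`hmod`), Agashe–Ribet–Stein 2006 Thm 2.6 (`hARS`) and the
Shu–Zhai §5.2 Table row 36a1 (`htab`)** — the p3 closer `P2.cornerFTwo_shuZhaiThirtySix_isogenyClass_byName`
read on the leaf. beyond-print: NO. [cite: ShuZhai2021, Thm. 1.2, Thm. 1.4, §5.2 Table row 36a1]
[cite: MilneADT2006, Thm. I.7.3] [cite: AgasheRibetStein2006, Thm. 2.6] [cite: BurungaleFlach2024, Cor. 2]
[cite: Miller2011LMS, Def. 1.1] -/
theorem wAllCornerFTwoInertShuZhaiThirtySix_of_facts (hCassels : bsdRHS_eq_of_isIsogenous)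
    (h12 : thm12_ranks_of_twists) (h14 : thm14_twoPartBSD_of_twists)
    (hCM : bsdTriple_of_hasCM_of_L_one_ne_zero) (hmod : hasEntireLFunction_rat)
    (hARS : AgasheRibetStein2006.cremona_abs_maninConstant_eq_one_of_level_le)
    (htab : table52_row36a1) : WAllCornerFTwoInertShuZhaiThirtySix :=
  fun W _ _ hcm hr1 hin hW ↦
    P2.cornerFTwo_shuZhaiThirtySix_isogenyClass_byName hCassels h12 h14 hCM hmod hARS htab W hcm hr1 hin hW

/-- **After the facts, the inert slices ARE the OFF-leaf**: granted the seven named facts, the two inert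
slices of row 12₂ hold iff `WAllCornerFTwoInertOffShuZhaiThirtySix` holds. [folklore] -/
theorem wAllCornerFTwoInert_iff_offShuZhai_of_facts (hCassels : bsdRHS_eq_of_isIsogenous)
    (h12 : thm12_ranks_of_twists) (h14 : thm14_twoPartBSD_of_twists)
    (hCM : bsdTriple_of_hasCM_of_L_one_ne_zero) (hmod : hasEntireLFunction_rat)
    (hARS : AgasheRibetStein2006.cremona_abs_maninConstant_eq_one_of_level_le)
    (htab : table52_row36a1) :
    (WAllCornerFTwoInertGood ∧ WAllCornerFTwoInertBad) ↔ WAllCornerFTwoInertOffShuZhaiThirtySix := by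
  rw [wAllCornerFTwoInert_iff_shuZhai_offShuZhai]
  exact ⟨fun h ↦ h.2,
    fun h ↦ ⟨wAllCornerFTwoInertShuZhaiThirtySix_of_facts hCassels h12 h14 hCM hmod hARS htab, h⟩⟩

end Summit.BirchSwinnertonDyer

end
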